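import Summits.BirchSwinnertonDyer.BirchSwinnertonDyer.Theorems.PrintCf2SplitBadTwoCMPrimaryLocalTypesOfDatum
import Summits.BirchSwinnertonDyer.BirchSwinnertonDyer.Theorems.PrintCf2SplitBadEisensteinTwoOrdinaryFiltrationAtTwo
import Literature.NumberTheory.EllipticCurves.KernelReductionTateFormInertiaProofs
import Literature.NumberTheory.GaloisRepresentations.DecompositionGroupOfCompletion
import HarnessLib

/-!
# Crux `PrintCf2.SplitBadTwoRankOneOfFacts` (item stmt-BirchSwinnertonDyer-20368), road α over the CM field:
# LOCAL PINNING of the two CM-primary summands `E[𝔮^∞]`, `E[𝔮̄^∞]` at a degree-one prime `𝔭 ∣ 2`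

Cell `bsd-print-cf2`, width seat `bsd-line-cf2-p1-w2` g8; `--supports stmt-BirchSwinnertonDyer-20368` (helper). HONEST FRAMING: nothing
here closes a crux or a stub; BSD is not proved by any of this; no summit statement is proved by this seat. THEOREMS ONLY (no
definition, no named fact, no `sorry`). FILE 2 of 2: the engine and the datum-relative dichotomy are FILE 1
`PrintCf2SplitBadTwoCMPrimaryLocalTypesOfDatum.lean`; this file supplies the datum and the inertia witness and states the
pinning theorems.

THE QUESTION (crux workfile `TURNKEY-20368-cmprimes-w2g7.md`, «Still missing 1»; LEAD g10's v8 typing of S3b′/S3c). For `W/ℚ`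
with `j = −3375` over a number field `K ∋ θ`, `θ² = −7`, a `K`-rational `π` with `π² = π − 2` and a `2`-adic root `r` of
`X² − X + 2`, the `2`-primary torsion is the direct sum of the two NAMED discrete `Γ_K`-modules (p646843, p647665)
`E[𝔮_r^∞] := (W.baseChange K).endEigenPrimaryTorsion 2 π r` and `E[𝔮_{1−r}^∞] := … (1 − r)`, each `≅ ℚ₂/ℤ₂` with `Γ_K` acting
through a character, `ψ_𝔮·ψ_𝔮̄ = ε`. Road α's frames fix a place `v ∣ 2` of `K`; the research stubs need to know WHICH of the two
modules is «`W[v̄^∞]`» — the summand unramified (up to the quadratic twist) at `v` — and the typing template displays this as the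
LOCAL CLAUSE «`GreenbergSelmer.inertia v` acts on the module through `{±1}`». The pair `(π, r)` cannot decide it (both
configurations occur, at `v` and at `v̄`). This file proves that the clause PINS: it holds for EXACTLY ONE of `r`, `1 − r`, and
it computes the local characters of both summands.

THE THEOREMS (ns `…Theorems.PrintCf2.CMPrimes`; `𝔭 ∣ 2` a place of `K` with `f(𝔭|2) = 1`, e.g. either place above the split `2`
of `ℚ(√−7)`):
* `endEigenPrimaryTorsion_two_localTypes` — **the main theorem**: the roots are ORDERED `(ρ, ρ')`, `{ρ, ρ'} = {r, 1 − r}`, and there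
  is a unit `α`, `α² = α − 2`, `α ∈ {r, 1 − r}` (the unit root of Frobenius of the good twist `49a1`) such that every `σ ∈ Γ_{K_𝔭}`
  of Frobenius degree `n` acts (U) on `E[𝔮_ρ^∞][2^k]` as any `N ≡ ±αⁿ (mod 2^k)` — UNRAMIFIED-TWIST type — and (R) on
  `E[𝔮_{ρ'}^∞][2^k]` as any `N ≡ ±ε(res σ)·α^{−n} (mod 2^k)` — KERNEL-OF-REDUCTION type — (signs `±1` depending on `σ` only: the
  quadratic twist), and (I) some inertia element of `Γ_{K_𝔭}` moves some point of `E[𝔮_{ρ'}^∞]` off `±` itself;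
* `endEigenPrimaryTorsion_two_pinningClause` / `…_pinningClause_unique` / `exists_cmEndo_root_pinningClause` — the v9 clause
  `∀ τ ∈ GreenbergSelmer.inertia v, ∀ x : ↥(… endEigenPrimaryTorsion 2 π r), τ • x = x ∨ τ • x = -x` (S3b′ output / S3c hypothesis)
  VERBATIM: holds for exactly one of `r`, `1 − r`; and S3b′'s pinned data `(π, r, clause)` EXIST for every frame;
* `endEigenPrimaryTorsion_two_inertia_smul` — **the pinning clause holds for `ρ` and fails for `ρ'`**: every
  `τ ∈ GreenbergSelmer.inertia 𝔭` acts on `E[𝔮_ρ^∞]` as `+1` or as `−1`, and some `τ ∈ GreenbergSelmer.inertia 𝔭` moves a point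
  of `E[𝔮_{ρ'}^∞]` off `±` itself; `endEigenPrimaryTorsion_two_inertia_smul_unique` — hence the clause singles out ONE root;
  `endEigenPrimaryTorsion_two_inertia_smul_of_isImaginaryQuadratic` — the same in the frames' currency (`K` imaginary quadratic,
  `v ≠ v̄` above `2`; `f(v|2) = 1` by `inertiaDeg_eq_one_of_ne_two`);
* (FILE 1) `endEigenPrimaryTorsion_two_localTypes_of_datum` — the dichotomy RELATIVE TO ANY Greenberg datum `(C, α)` carrying the
  two signed clauses of p640618's `stub_ordinaryFiltrationAtTwo` and any inertia element `τ₀` with `ε(res τ₀) ≠ 1`; and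
  `eq_endEigenPrimaryTorsion_two_of_divisible` — a `2`-divisible datum (Greenberg's reduction line is) equals `E[𝔮_{ρ'}^∞]`;
* the witness `exists_isFrobPow_zero_cyclotomicCharacter_ne` (an inertia element of `Γ_{K_𝔭}` with `ε ∉ {±1}`, from the tree's
  `exists_mem_inertia_forall_cyclotomicCharacter_pow_ne_one` at `𝔓₀ = adicCompletionPrime K 𝔭` and
  `inertia_adicCompletionPrime_eq_map_absInertia`); `inertiaDeg_eq_one_of_ne_two` (split `2` in a quadratic field has `f = 1`).

THE ARGUMENT. Let `C` be the Greenberg datum at `(K, 𝔭)` (p640618's chain: `EisensteinTwo.ordinaryFiltration_rat_two_of_j_eq` on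
`49a1`, transported along the twist and to `(K, 𝔭)` by `ordinaryFiltration_baseChange_of_inertiaDeg_eq_one`) and `τ₀` the
witness. If `C = ⊤`, the line clause gives ONE scalar `±ε(res τ₀)` for `τ₀` on both summands, so `ε(res τ₀)² = ε(res τ₀)`, i.e.
`ε(res τ₀) = 1` — excluded; if BOTH summands were `⊄ C`, both would carry the quotient scalar `±1` at `τ₀`, so `1 = ε(res τ₀)` —
excluded. Hence exactly one summand lies in `C` (it inherits the line character) and the other meets `C` in a finite group
killed by `2^a` (it inherits the quotient character). This is Deuring/Serre–Tate bookkeeping — Rubin, LNM 1716, Lemma 3.6 (ii)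
(`E[𝔭ⁿ] ⊂ E₁` for the inseparable `[πⁿ]`), Thm. 3.15 (ii) and Cor. 3.17 (`K(E[𝔭̄ⁿ])/K` unramified at `𝔭`) — for the additive
twists of `49a1`, in the kernel's currency; beyond-print theorem: no.

WHAT THIS DOES NOT DO: decide `ρ ∈ {r, 1 − r}` from `(π, r)` (impossible without the normalised `[·] : 𝓞_K ≅ End_K` via the
invariant differential, not in the tree); prove that the roles of `ρ`, `ρ'` swap between `v` and `v̄` (the complex-conjugation
transport `D_v ↦ D_{v̄}`, not in the tree in this currency); package the level-wise scalars as continuous characters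
`Γ_K → ℤ₂ˣ`.

References: K. Rubin, *Elliptic curves with complex multiplication and the conjecture of Birch and Swinnerton-Dyer*, LNM 1716
(1999), §2, §3 Lemma 3.6, Thm. 3.15, Cor. 3.17, Prop. 5.4; R. Greenberg, LNM 1716 (1999) §2 pp. 62–63, 70; R. Greenberg,
*Iwasawa theory for p-adic representations* (1989) §1 p. 98; [SilvermanAEC2009] III.8.1, X.5 Cor. 5.4.1; [SerreAbelianLadic1968]
Ch. I §1.2; [NeukirchANT1999] Ch. I §8 (8.2), Ch. II (7.13), §9 (9.6).
-/

noncomputable section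

open scoped Classical

set_option linter.dupNamespace false
set_option autoImplicit false

namespace Summit.BirchSwinnertonDyer.BirchSwinnertonDyer.Theorems.PrintCf2.CMPrimes

/-! ## The theorems at a degree-one prime `𝔭 ∣ 2`: the datum (p640618 chain), the inertia witness, the pinning -/

section Pinning

open WeierstrassCurve Literature.NumberTheory.EllipticCurves Literature.NumberTheory.GaloisRepresentations Field NumberField
  IsDedekindDomain Summit.BirchSwinnertonDyer.Rank1Residual.X11b

variable (W : WeierstrassCurve ℚ) [W.IsElliptic] (K : Type) [Field K] [NumberField K]

/-- **An inertia element at `𝔭 ∣ 2` whose cyclotomic character is neither `1` nor `−1`** (in the local group `Γ_{K_𝔭}`, Frobenius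
degree `0`): the tree's «`χ₂` is ramified above `2` with a value no power of which is `1`»
(`exists_mem_inertia_forall_cyclotomicCharacter_pow_ne_one`) at the prime `𝔓₀ = adicCompletionPrime K 𝔭`, whose inertia group
is `res (I_{K_𝔭})` (`inertia_adicCompletionPrime_eq_map_absInertia`). [cite: SerreAbelianLadic1968, Ch. I §1.2]
[cite: NeukirchANT1999, Ch. II (7.13) and §9 Prop. (9.6)] -/
theorem exists_isFrobPow_zero_cyclotomicCharacter_ne (𝔭 : HeightOneSpectrum (𝓞 K)) (h𝔭 : ((2 : ℕ) : 𝓞 K) ∈ 𝔭.asIdeal) :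
    ∃ τ₀ : absoluteGaloisGroup (𝔭.adicCompletion K), IsFrobPow τ₀ 0 ∧
      GaloisRep.cyclotomicCharacter K 2 (absGaloisRestrict K (𝔭.adicCompletion K) τ₀) ≠ 1 ∧
      GaloisRep.cyclotomicCharacter K 2 (absGaloisRestrict K (𝔭.adicCompletion K) τ₀) ≠ -1 := by
  haveI : Fact (Nat.Prime 2) := ⟨Nat.prime_two⟩
  obtain ⟨τ, hτI, hτpow⟩ := exists_mem_inertia_forall_cyclotomicCharacter_pow_ne_one 2 h𝔭
    (adicCompletionPrime_mem_primesAbove K 𝔭)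
  rw [inertia_adicCompletionPrime_eq_map_absInertia K 𝔭, Subgroup.mem_map] at hτI
  obtain ⟨τ₀, hτ₀I, hτ₀⟩ := hτI
  have hτ₀' : absGaloisRestrict K (𝔭.adicCompletion K) τ₀ = τ := hτ₀
  refine ⟨τ₀, isFrobPow_zero_iff_mem_absInertia.mpr hτ₀I, ?_, ?_⟩
  · rw [hτ₀']
    simpa using hτpow 1 one_pos
  · rw [hτ₀']
    intro h
    exact hτpow 2 two_pos (by rw [h, neg_one_sq])

/-- **LOCAL PINNING OF THE CM-PRIMARY SUMMANDS AT A DEGREE-ONE PRIME `𝔭 ∣ 2` — the main theorem.** `W/ℚ` elliptic, `j = −3375`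
(a `ℚ`-model of a quadratic twist of `49a1`), `K` a number field with `θ² = −7`, `𝔭 ∣ 2` a place of `K` with `f(𝔭|2) = 1`,
`π ∈ End_K(E_K)` with `π² = π − 2`, `r` a `2`-adic root of `X² − X + 2`. Then the two roots are ORDERED `(ρ, ρ')` and there is
a unit `α`, `α² = α − 2` (the unit root of Frobenius of the good twist; `α ∈ {r, 1 − r}`, `eq_or_eq_one_sub_of_root_two`) with:
(U) every `σ ∈ Γ_{K_𝔭}` of Frobenius degree `n` acts on `E[𝔮_ρ^∞][2^k]` as any `N ≡ ±αⁿ (mod 2^k)` — `E[𝔮_ρ^∞]` is of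
UNRAMIFIED-TWIST type at `𝔭` (inertia acts through `±1`); (R) on `E[𝔮_{ρ'}^∞][2^k]` as any `N ≡ ±ε(res σ)·α^{−n}` —
KERNEL-OF-REDUCTION type; (I) `E[𝔮_{ρ'}^∞]` is NOT finitely ramified: some inertia element moves some point of some level
off `±` itself. This is Deuring's «`E[𝔭̄^∞]` is unramified at `𝔭`, `E[𝔭^∞]` is the formal group at `𝔭`» (Rubin LNM 1716 Lemma
3.6 (ii), Thm. 3.15 (ii), Cor. 3.17) transported to the additive twists, in the kernel's currency — which of `r`, `1 − r` is `ρ`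
is NOT decided by `(π, r)` (both configurations occur, at `𝔭` and at `𝔭̄`), hence the ordering is an OUTPUT. Inputs: p640618's
chain (`EisensteinTwo.ordinaryFiltration_rat_two_of_j_eq` + `ordinaryFiltration_baseChange_of_inertiaDeg_eq_one`), p647665
(`endEigenPrimaryTorsion_two_structure`, `…_characters_mul`), `exists_isFrobPow_zero_cyclotomicCharacter_ne`.
[cite: Rubin1999, §3 Lemma 3.6 (ii), Thm. 3.15 (ii), Cor. 3.17] [cite: GreenbergLNM1716, §2 pp. 62–63 and p. 70]
[cite: SilvermanAEC2009, X.5 Cor. 5.4.1] -/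
theorem endEigenPrimaryTorsion_two_localTypes (hj : W.j = -3375) {θ : K} (hθ : θ ^ 2 = -7)
    (π : (W.baseChange K).endRing) (hrel : (π : AddMonoid.End (W.baseChange K).geomPoints) * π = π - 2)
    {r : ℤ_[2]} (hr : r * r = r - 2) (𝔭 : HeightOneSpectrum (𝓞 K)) (h𝔭 : ((2 : ℕ) : 𝓞 K) ∈ 𝔭.asIdeal)
    (hf : 𝔭.asIdeal.inertiaDeg (𝓞 ℚ) = 1) :
    ∃ (ρ ρ' : ℤ_[2]) (α : ℤ_[2]ˣ), ((ρ = r ∧ ρ' = 1 - r) ∨ (ρ = 1 - r ∧ ρ' = r)) ∧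
      (α : ℤ_[2]) ^ 2 = (α : ℤ_[2]) - 2 ∧ ((α : ℤ_[2]) = r ∨ (α : ℤ_[2]) = 1 - r) ∧
      (∀ (σ : absoluteGaloisGroup (𝔭.adicCompletion K)) (n : ℕ), IsFrobPow σ (n : ℤ) →
        ∃ s : ℤ, (s = 1 ∨ s = -1) ∧
          ∀ (k : ℕ), ∀ x ∈ (W.baseChange K).endEigenPrimaryTorsion 2 π ρ, 2 ^ k • x = 0 →
            ∀ N : ℤ, ((N : ℤ_[2]) - s * ((α ^ n : ℤ_[2]ˣ) : ℤ_[2])) ∈ (Ideal.span {(2 : ℤ_[2]) ^ k} : Ideal ℤ_[2]) →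
              absGaloisRestrict K (𝔭.adicCompletion K) σ • x = N • x) ∧
      (∀ (σ : absoluteGaloisGroup (𝔭.adicCompletion K)) (n : ℕ), IsFrobPow σ (n : ℤ) →
        ∃ s : ℤ, (s = 1 ∨ s = -1) ∧
          ∀ (k : ℕ), ∀ x ∈ (W.baseChange K).endEigenPrimaryTorsion 2 π ρ', 2 ^ k • x = 0 →
            ∀ N : ℤ, ((N : ℤ_[2]) - s *
                ((GaloisRep.cyclotomicCharacter K 2 (absGaloisRestrict K (𝔭.adicCompletion K) σ) * (α⁻¹) ^ n :
                  ℤ_[2]ˣ) : ℤ_[2])) ∈ (Ideal.span {(2 : ℤ_[2]) ^ k} : Ideal ℤ_[2]) →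
              absGaloisRestrict K (𝔭.adicCompletion K) σ • x = N • x) ∧
      (∃ τ₀ : absoluteGaloisGroup (𝔭.adicCompletion K), IsFrobPow τ₀ 0 ∧
        ∃ (k : ℕ), ∃ x ∈ (W.baseChange K).endEigenPrimaryTorsion 2 π ρ', 2 ^ k • x = 0 ∧
          absGaloisRestrict K (𝔭.adicCompletion K) τ₀ • x ≠ x ∧ absGaloisRestrict K (𝔭.adicCompletion K) τ₀ • x ≠ -x) := by
  haveI : Fact (Nat.Prime 2) := ⟨Nat.prime_two⟩
  -- the signed ordinary-filtration datum at `(K, 𝔭)` (p640618's chain, case `j = −3375`)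
  have hpv : ((2 : ℕ) : 𝓞 ℚ) ∈ (ratPlace 2).asIdeal :=
    (natCast_mem_asIdeal_iff_eq_primesEquiv_symm (ratPlace 2) Fact.out).mpr rfl
  haveI := SchneiderFreeAdditiveX3.liesOver_of_natCast_mem hpv h𝔭
  obtain ⟨C₀, α, hα, hchar₀⟩ := EisensteinTwo.ordinaryFiltration_rat_two_of_j_eq cm7
    EisensteinTwo.not_two_dvd_minimalDiscriminantInt_cm7 GoldfeldGoodTwists.frobeniusTrace_cm7_two
    (by rw [j_cm7]; norm_num) (by rw [j_cm7]; norm_num) W (by rw [hj, j_cm7]) hpv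
  obtain ⟨C, hchar⟩ :=
    EisensteinTwo.ordinaryFiltration_baseChange_of_inertiaDeg_eq_one W K (ratPlace 2) 𝔭 hf C₀ α hchar₀
  -- the inertia witness
  obtain ⟨τ₀, hτ₀, hu₁, hu₂⟩ := exists_isFrobPow_zero_cyclotomicCharacter_ne K 𝔭 h𝔭
  obtain ⟨ρ, ρ', hρρ', -, hle, hU, hR⟩ :=
    endEigenPrimaryTorsion_two_localTypes_of_datum W K hj hθ π hrel hr 𝔭 C α hchar hτ₀ hu₁
  refine ⟨ρ, ρ', α, hρρ', hα, eq_or_eq_one_sub_of_root_two (by rw [← sq]; exact hα) hr, hU, hR, τ₀, hτ₀, ?_⟩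
  -- (I): on `E[𝔮_{ρ'}^∞] ≤ C` the inertia element `τ₀` acts as `±ε(res τ₀) ≠ ±1`
  have hρ' : ρ' * ρ' = ρ' - 2 := by
    rcases hρρ' with ⟨-, rfl⟩ | ⟨-, rfl⟩
    · linear_combination hr
    · exact hr
  obtain ⟨s, hs, hRτ⟩ := hR τ₀ 0 (by exact_mod_cast hτ₀)
  simp only [pow_zero, mul_one] at hRτ
  set u : ℤ_[2]ˣ := GaloisRep.cyclotomicCharacter K 2 (absGaloisRestrict K (𝔭.adicCompletion K) τ₀) with hu_def
  have hu₁' : (u : ℤ_[2]) ≠ 1 := fun h ↦ hu₁ (Units.ext h)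
  have hu₂' : (u : ℤ_[2]) ≠ -1 := fun h ↦ hu₂ (Units.ext (by rw [h, Units.val_neg, Units.val_one]))
  have ht₁ : (s : ℤ_[2]) * (u : ℤ_[2]) ≠ 1 := by
    rcases hs with rfl | rfl
    · push_cast; rw [one_mul]; exact hu₁'
    · push_cast; rw [neg_one_mul]; exact fun h ↦ hu₂' (by rw [← h, neg_neg])
  have ht₂ : (s : ℤ_[2]) * (u : ℤ_[2]) ≠ -1 := by
    rcases hs with rfl | rfl
    · push_cast; rw [one_mul]; exact hu₂'
    · push_cast; rw [neg_one_mul]; exact fun h ↦ hu₁' (neg_injective h)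
  exact endEigenPrimaryTorsion_two_exists_smul_ne W K hj hθ π hrel hρ' _ ht₁ ht₂ hRτ

/-- **SPLIT PRIMES OF A QUADRATIC FIELD HAVE DEGREE ONE**: `[K:ℚ] = 2`, `v ≠ v̄` two places above `2` ⟹ `f(v|2) = 1`
(`placesOver_trichotomy_of_finrank_eq_two`: the inert and ramified cases have a single place above `2`).
[cite: NeukirchANT1999, Ch. I §8 Prop. (8.2)] -/
theorem inertiaDeg_eq_one_of_ne_two (hK2 : Module.finrank ℚ K = 2) {v vbar : HeightOneSpectrum (𝓞 K)}
    (hv : ((2 : ℕ) : 𝓞 K) ∈ v.asIdeal) (hvbar : ((2 : ℕ) : 𝓞 K) ∈ vbar.asIdeal) (hne : vbar ≠ v) :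
    v.asIdeal.inertiaDeg (𝓞 ℚ) = 1 := by
  haveI : Fact (Nat.Prime 2) := ⟨Nat.prime_two⟩
  have hv' : v.under (𝓞 ℚ) = ratPlace 2 := under_eq_ratPlace_of_mem hv
  have hvbar' : vbar.under (𝓞 ℚ) = ratPlace 2 := under_eq_ratPlace_of_mem hvbar
  rcases placesOver_trichotomy_of_finrank_eq_two K hK2 (ratPlace 2) with
    ⟨w₁, w₂, -, -, hef⟩ | ⟨w, hset, -, -⟩ | ⟨w, hset, -, -⟩
  · exact (hef v hv').2
  · have h1 : v ∈ ({w} : Set (HeightOneSpectrum (𝓞 K))) := hset ▸ hv'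
    have h2 : vbar ∈ ({w} : Set (HeightOneSpectrum (𝓞 K))) := hset ▸ hvbar'
    exact absurd ((Set.mem_singleton_iff.mp h2).trans (Set.mem_singleton_iff.mp h1).symm) hne
  · have h1 : v ∈ ({w} : Set (HeightOneSpectrum (𝓞 K))) := hset ▸ hv'
    have h2 : vbar ∈ ({w} : Set (HeightOneSpectrum (𝓞 K))) := hset ▸ hvbar'
    exact absurd ((Set.mem_singleton_iff.mp h2).trans (Set.mem_singleton_iff.mp h1).symm) hne

/-- **THE PINNING CLAUSE IS SATISFIABLE AND PINS: the inertia group `I_𝔭 = GreenbergSelmer.inertia 𝔭` acts on EXACTLY ONE of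
the two CM summands through `{±1}`.** `W/ℚ` elliptic, `j = −3375`, `K ∋ θ`, `θ² = −7`, `𝔭 ∣ 2` with `f(𝔭|2) = 1`,
`π² = π − 2`, `r² = r − 2`: the roots are ordered `(ρ, ρ')` with (a) every `τ ∈ I_𝔭` acting on `E[𝔮_ρ^∞]` as `+1` or `−1`
(pointwise, sign depending on `τ` only) — the displayed local clause «`↥((W.baseChange K).endEigenPrimaryTorsion 2 π ρ)` is
the summand finitely ramified at `𝔭`, i.e. `W[𝔭̄₀^∞]`» of the road-α typing template (crux workfile
`TURNKEY-20368-cmprimes-w2g7.md`) HOLDS for `ρ`; (b) some `τ ∈ I_𝔭` moves some point of `E[𝔮_{ρ'}^∞]` off `±` itself — the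
clause FAILS for `ρ'`. [cite: Rubin1999, §3 Lemma 3.6 (ii) and Cor. 3.17] [cite: Greenberg1989, §1 p. 98] -/
theorem endEigenPrimaryTorsion_two_inertia_smul (hj : W.j = -3375) {θ : K} (hθ : θ ^ 2 = -7)
    (π : (W.baseChange K).endRing) (hrel : (π : AddMonoid.End (W.baseChange K).geomPoints) * π = π - 2)
    {r : ℤ_[2]} (hr : r * r = r - 2) (𝔭 : HeightOneSpectrum (𝓞 K)) (h𝔭 : ((2 : ℕ) : 𝓞 K) ∈ 𝔭.asIdeal)
    (hf : 𝔭.asIdeal.inertiaDeg (𝓞 ℚ) = 1) :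
    ∃ ρ ρ' : ℤ_[2], ((ρ = r ∧ ρ' = 1 - r) ∨ (ρ = 1 - r ∧ ρ' = r)) ∧
      (∀ τ ∈ GreenbergSelmer.inertia 𝔭, (∀ x ∈ (W.baseChange K).endEigenPrimaryTorsion 2 π ρ, τ • x = x) ∨
        (∀ x ∈ (W.baseChange K).endEigenPrimaryTorsion 2 π ρ, τ • x = -x)) ∧
      (∃ τ ∈ GreenbergSelmer.inertia 𝔭, ∃ x ∈ (W.baseChange K).endEigenPrimaryTorsion 2 π ρ', τ • x ≠ x ∧ τ • x ≠ -x) := by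
  haveI : Fact (Nat.Prime 2) := ⟨Nat.prime_two⟩
  obtain ⟨ρ, ρ', α, hρρ', -, -, hU, -, τ₀, hτ₀, k, x, hx, -, hx₁, hx₂⟩ :=
    endEigenPrimaryTorsion_two_localTypes W K hj hθ π hrel hr 𝔭 h𝔭 hf
  refine ⟨ρ, ρ', hρρ', fun τ hτ ↦ ?_, ⟨absGaloisRestrict K (𝔭.adicCompletion K) τ₀,
    Subgroup.mem_map.mpr ⟨τ₀, isFrobPow_zero_iff_mem_absInertia.mp hτ₀, rfl⟩, x, hx, hx₁, hx₂⟩⟩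
  obtain ⟨σ, hσI, rfl⟩ := Subgroup.mem_map.mp hτ
  obtain ⟨s, hs, h⟩ := hU σ 0 (by exact_mod_cast (isFrobPow_zero_iff_mem_absInertia.mpr hσI))
  simp only [pow_zero, Units.val_one, mul_one] at h
  have key : ∀ x ∈ (W.baseChange K).endEigenPrimaryTorsion 2 π ρ, absGaloisRestrict K (𝔭.adicCompletion K) σ • x = s • x := by
    intro x hx
    obtain ⟨k, hk⟩ : ∃ k : ℕ, 2 ^ k • x = 0 := by
      obtain ⟨k, hk⟩ := (AddCommGroup.mem_primaryComponent).mp x.2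
      exact ⟨k, Subtype.ext (by rw [AddSubmonoidClass.coe_nsmul, ZeroMemClass.coe_zero]; exact hk)⟩
    exact h k x hx hk s (by rw [sub_self]; exact Submodule.zero_mem _)
  rcases hs with rfl | rfl
  · exact Or.inl fun x hx ↦ (key x hx).trans (one_zsmul x)
  · exact Or.inr fun x hx ↦ (key x hx).trans (neg_one_zsmul x)

/-- **UNIQUENESS OF THE PINNED ROOT.** In the same situation, if `I_𝔭` acts through `{±1}` (pointwise) on `E[𝔮_{ρ₁}^∞]` and on
`E[𝔮_{ρ₂}^∞]` with `ρ₁, ρ₂ ∈ {r, 1 − r}`, then `ρ₁ = ρ₂`: the pinning clause singles out ONE of the two summands.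
[cite: Rubin1999, §3 Lemma 3.6 (ii) and Cor. 3.17] -/
theorem endEigenPrimaryTorsion_two_inertia_smul_unique (hj : W.j = -3375) {θ : K} (hθ : θ ^ 2 = -7)
    (π : (W.baseChange K).endRing) (hrel : (π : AddMonoid.End (W.baseChange K).geomPoints) * π = π - 2)
    {r : ℤ_[2]} (hr : r * r = r - 2) (𝔭 : HeightOneSpectrum (𝓞 K)) (h𝔭 : ((2 : ℕ) : 𝓞 K) ∈ 𝔭.asIdeal)
    (hf : 𝔭.asIdeal.inertiaDeg (𝓞 ℚ) = 1) {ρ₁ ρ₂ : ℤ_[2]} (hρ₁ : ρ₁ = r ∨ ρ₁ = 1 - r) (hρ₂ : ρ₂ = r ∨ ρ₂ = 1 - r)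
    (h₁ : ∀ τ ∈ GreenbergSelmer.inertia 𝔭, ∀ x ∈ (W.baseChange K).endEigenPrimaryTorsion 2 π ρ₁, τ • x = x ∨ τ • x = -x)
    (h₂ : ∀ τ ∈ GreenbergSelmer.inertia 𝔭, ∀ x ∈ (W.baseChange K).endEigenPrimaryTorsion 2 π ρ₂, τ • x = x ∨ τ • x = -x) :
    ρ₁ = ρ₂ := by
  obtain ⟨ρ, ρ', hρρ', -, τ, hτ, x, hx, hx₁, hx₂⟩ := endEigenPrimaryTorsion_two_inertia_smul W K hj hθ π hrel hr 𝔭 h𝔭 hf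
  have hne₁ : ρ₁ ≠ ρ' := by
    rintro rfl
    rcases h₁ τ hτ x hx with h | h
    · exact hx₁ h
    · exact hx₂ h
  have hne₂ : ρ₂ ≠ ρ' := by
    rintro rfl
    rcases h₂ τ hτ x hx with h | h
    · exact hx₁ h
    · exact hx₂ h
  rcases hρρ' with ⟨-, rfl⟩ | ⟨-, rfl⟩
  · rcases hρ₁ with rfl | rfl
    · rcases hρ₂ with rfl | rfl
      · rfl
      · exact absurd rfl hne₂
    · exact absurd rfl hne₁
  · rcases hρ₁ with rfl | rfl
    · exact absurd rfl hne₁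
    · rcases hρ₂ with rfl | rfl
      · exact absurd rfl hne₂
      · rfl

/-- **FRAME CURRENCY (road α S3b′/S3c binders): `K` imaginary quadratic with `2 = v·v̄` split.** For `W/ℚ` elliptic with
`j = −3375`, `K` imaginary quadratic with `θ² = −7`, `v ≠ v̄` the two places above `2` (so `f(v|2) = 1`), `π ∈ End_K(E_K)` with
`π² = π − 2` and a root `r`: AT THE PLACE `v`, exactly one of the two named modules `E[𝔮_r^∞]`, `E[𝔮_{1−r}^∞]`
(`(W.baseChange K).endEigenPrimaryTorsion 2 π ·`) has `GreenbergSelmer.inertia v` acting through `{±1}` — this is the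
module the typing template calls `W[v̄^∞]` — and the other does not. (Which of the two it is at `v̄` is the mirror statement
at `v̄`; that the roles SWAP between `v` and `v̄` is the global complex-conjugation argument, not proved here.)
[cite: Rubin1999, §3 Lemma 3.6 (ii) and Cor. 3.17] [cite: NeukirchANT1999, Ch. I §8 Prop. (8.2)] -/
theorem endEigenPrimaryTorsion_two_inertia_smul_of_isImaginaryQuadratic (hj : W.j = -3375)
    (hK : IsImaginaryQuadratic K) {θ : K} (hθ : θ ^ 2 = -7)
    (π : (W.baseChange K).endRing) (hrel : (π : AddMonoid.End (W.baseChange K).geomPoints) * π = π - 2)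
    {r : ℤ_[2]} (hr : r * r = r - 2) {v vbar : HeightOneSpectrum (𝓞 K)}
    (hv : ((2 : ℕ) : 𝓞 K) ∈ v.asIdeal) (hvbar : ((2 : ℕ) : 𝓞 K) ∈ vbar.asIdeal) (hne : vbar ≠ v) :
    ∃ ρ ρ' : ℤ_[2], ((ρ = r ∧ ρ' = 1 - r) ∨ (ρ = 1 - r ∧ ρ' = r)) ∧
      (∀ τ ∈ GreenbergSelmer.inertia v, (∀ x ∈ (W.baseChange K).endEigenPrimaryTorsion 2 π ρ, τ • x = x) ∨
        (∀ x ∈ (W.baseChange K).endEigenPrimaryTorsion 2 π ρ, τ • x = -x)) ∧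
      (∃ τ ∈ GreenbergSelmer.inertia v, ∃ x ∈ (W.baseChange K).endEigenPrimaryTorsion 2 π ρ', τ • x ≠ x ∧ τ • x ≠ -x) :=
  endEigenPrimaryTorsion_two_inertia_smul W K hj hθ π hrel hr v hv (inertiaDeg_eq_one_of_ne_two K hK.1 hv hvbar hne)

/-- **THE v9 PINNING CLAUSE, VERBATIM, holds for exactly one root.** In the currency of the registered stubs
`stub_restrictedMainConj_two` (S3b′, output) / `stub_restrictedControl_two` (S3c, hypothesis) of road α's skeleton v9 — the clause
`∀ τ ∈ GreenbergSelmer.inertia v, ∀ x : ↥((W.baseChange K).endEigenPrimaryTorsion 2 π r), τ • x = x ∨ τ • x = -x` on the SUBTYPE with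
its restricted `Γ_K`-action (p646843 `endEigenPrimaryTorsion.instDistribMulAction`) —: for `𝔭 ∣ 2` with `f(𝔭|2) = 1` the roots are
ordered `(ρ, ρ')` so that the clause HOLDS at `𝔭` for `ρ` and FAILS for `ρ'`. [cite: Rubin1999, §3 Lemma 3.6 (ii) and Cor. 3.17] -/
theorem endEigenPrimaryTorsion_two_pinningClause (hj : W.j = -3375) {θ : K} (hθ : θ ^ 2 = -7)
    (π : (W.baseChange K).endRing) (hrel : (π : AddMonoid.End (W.baseChange K).geomPoints) * π = π - 2)
    {r : ℤ_[2]} (hr : r * r = r - 2) (𝔭 : HeightOneSpectrum (𝓞 K)) (h𝔭 : ((2 : ℕ) : 𝓞 K) ∈ 𝔭.asIdeal)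
    (hf : 𝔭.asIdeal.inertiaDeg (𝓞 ℚ) = 1) :
    ∃ ρ ρ' : ℤ_[2], ((ρ = r ∧ ρ' = 1 - r) ∨ (ρ = 1 - r ∧ ρ' = r)) ∧
      (∀ τ ∈ GreenbergSelmer.inertia 𝔭, ∀ x : ↥((W.baseChange K).endEigenPrimaryTorsion 2 π ρ), τ • x = x ∨ τ • x = -x) ∧
      ¬ (∀ τ ∈ GreenbergSelmer.inertia 𝔭, ∀ x : ↥((W.baseChange K).endEigenPrimaryTorsion 2 π ρ'), τ • x = x ∨ τ • x = -x) := by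
  obtain ⟨ρ, ρ', hρρ', hρ, τ, hτ, x, hx, hx₁, hx₂⟩ := endEigenPrimaryTorsion_two_inertia_smul W K hj hθ π hrel hr 𝔭 h𝔭 hf
  refine ⟨ρ, ρ', hρρ', fun τ hτ x ↦ ?_, fun h ↦ ?_⟩
  · rcases hρ τ hτ with h | h
    · exact Or.inl (Subtype.ext (by rw [endEigenPrimaryTorsion.coe_smul]; exact h x x.2))
    · exact Or.inr (Subtype.ext (by rw [endEigenPrimaryTorsion.coe_smul, AddSubgroup.coe_neg]; exact h x x.2))
  · rcases h τ hτ ⟨x, hx⟩ with h | h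
    · exact hx₁ (by simpa [endEigenPrimaryTorsion.coe_smul] using congrArg Subtype.val h)
    · exact hx₂ (by simpa [endEigenPrimaryTorsion.coe_smul] using congrArg Subtype.val h)

/-- **The v9 clause PINS**: if it holds at `𝔭` for `ρ₁` and for `ρ₂`, both in `{r, 1 − r}`, then `ρ₁ = ρ₂` — so S3c's hypothesis
«`(π, r)` pinned at `v`» determines the module `E[𝔮_r^∞]` among the two summands, and S3b′/S3c speak about the SAME `W[v̄^∞]`.
[cite: Rubin1999, §3 Lemma 3.6 (ii) and Cor. 3.17] -/
theorem endEigenPrimaryTorsion_two_pinningClause_unique (hj : W.j = -3375) {θ : K} (hθ : θ ^ 2 = -7)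
    (π : (W.baseChange K).endRing) (hrel : (π : AddMonoid.End (W.baseChange K).geomPoints) * π = π - 2)
    {r : ℤ_[2]} (hr : r * r = r - 2) (𝔭 : HeightOneSpectrum (𝓞 K)) (h𝔭 : ((2 : ℕ) : 𝓞 K) ∈ 𝔭.asIdeal)
    (hf : 𝔭.asIdeal.inertiaDeg (𝓞 ℚ) = 1) {ρ₁ ρ₂ : ℤ_[2]} (hρ₁ : ρ₁ = r ∨ ρ₁ = 1 - r) (hρ₂ : ρ₂ = r ∨ ρ₂ = 1 - r)
    (h₁ : ∀ τ ∈ GreenbergSelmer.inertia 𝔭, ∀ x : ↥((W.baseChange K).endEigenPrimaryTorsion 2 π ρ₁), τ • x = x ∨ τ • x = -x)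
    (h₂ : ∀ τ ∈ GreenbergSelmer.inertia 𝔭, ∀ x : ↥((W.baseChange K).endEigenPrimaryTorsion 2 π ρ₂), τ • x = x ∨ τ • x = -x) :
    ρ₁ = ρ₂ := by
  refine endEigenPrimaryTorsion_two_inertia_smul_unique W K hj hθ π hrel hr 𝔭 h𝔭 hf hρ₁ hρ₂ (fun τ hτ x hx ↦ ?_)
    (fun τ hτ x hx ↦ ?_)
  · rcases h₁ τ hτ ⟨x, hx⟩ with h | h
    · exact Or.inl (by simpa [endEigenPrimaryTorsion.coe_smul] using congrArg Subtype.val h)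
    · exact Or.inr (by simpa [endEigenPrimaryTorsion.coe_smul] using congrArg Subtype.val h)
  · rcases h₂ τ hτ ⟨x, hx⟩ with h | h
    · exact Or.inl (by simpa [endEigenPrimaryTorsion.coe_smul] using congrArg Subtype.val h)
    · exact Or.inr (by simpa [endEigenPrimaryTorsion.coe_smul] using congrArg Subtype.val h)

/-- **NON-VACUITY OF S3b′'s PINNED DATA `(π, π² = π − 2, r, r² = r − 2, clause at v)` — the first five components of the
existential of `stub_restrictedMainConj_two`, in the frames' currency.** `W/ℚ` elliptic with `j = −3375`, `K` imaginary quadratic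
with `θ² = −7`, `v ≠ v̄` above `2`: there ARE a `K`-rational `π` with `π² = π − 2` (-w2 g7 `exists_endRing_cmEndo_two`), a root `r`
(`exists_padicInt_two_root`, flipped to `1 − r` if needed) and the v9 pinning clause at `v` for `(π, r)`. What remains research in S3b′
is the line `κ*`, the dual datum and the value — not the module. [cite: Rubin1999, §2, §3 Cor. 3.17 and Prop. 5.4]
[cite: SilvermanATAEC1994, II §2 Thm. 2.2(b)] -/
theorem exists_cmEndo_root_pinningClause (hj : W.j = -3375) (hK : IsImaginaryQuadratic K) {θ : K} (hθ : θ ^ 2 = -7)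
    {v vbar : HeightOneSpectrum (𝓞 K)} (hv : ((2 : ℕ) : 𝓞 K) ∈ v.asIdeal) (hvbar : ((2 : ℕ) : 𝓞 K) ∈ vbar.asIdeal)
    (hne : vbar ≠ v) :
    ∃ (π : (W.baseChange K).endRing) (_ : (π : AddMonoid.End (W.baseChange K).geomPoints) * π = π - 2)
      (r : ℤ_[2]) (_ : r * r = r - 2),
      ∀ τ ∈ GreenbergSelmer.inertia v, ∀ x : ↥((W.baseChange K).endEigenPrimaryTorsion 2 π r), τ • x = x ∨ τ • x = -x := by
  obtain ⟨π, hrel, -, -⟩ := exists_endRing_cmEndo_two W hj K hθ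
  obtain ⟨r₀, hr₀, -⟩ := exists_padicInt_two_root
  obtain ⟨ρ, ρ', hρρ', hρ, -⟩ := endEigenPrimaryTorsion_two_pinningClause W K hj hθ π hrel hr₀ v hv
    (inertiaDeg_eq_one_of_ne_two K hK.1 hv hvbar hne)
  have hρ2 : ρ * ρ = ρ - 2 := by
    rcases hρρ' with ⟨rfl, -⟩ | ⟨rfl, -⟩
    · exact hr₀
    · linear_combination hr₀
  exact ⟨π, hrel, ρ, hρ2, hρ⟩

end Pinning

end Summit.BirchSwinnertonDyer.BirchSwinnertonDyer.Theorems.PrintCf2.CMPrimes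

end
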